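import Literature.NumberTheory.Automorphic.WeightOneOrdinaryLiftGaloisProofs
import Literature.NumberTheory.Automorphic.DeligneSerreThm46bHolds
import Literature.NumberTheory.GaloisRepresentations.DecompositionGroupOfCompletion
import Literature.NumberTheory.GaloisRepresentations.DyadicMonomialLiftUnramified
import HarnessLib

/-!
# `a_p(f)` is a `p`-adic unit for a weight-one newform whose Galois representation is, at `p`,
# a sum of two characters with exactly one of them unramified (Deligne–Serre Thm. 4.6 (b);
# proofs only)

Topic `Literature/NumberTheory/Automorphic`; namespace `Literature.NumberTheory.Automorphic`.
THEOREMS ONLY (no definition, no named fact; D-0026).  Input of the RAMIFIED case of the classical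
substitute for [WilesOrdinary, Theorem 3] in Allen, Compos. Math. 150 (2014), Lemma 87 (the
companion files `WeightOneOrdinaryLiftGaloisProofs`, `WeightOneOrdinaryLiftRamifiedProofs`).

**Statements.**
* `eulerPolynomial_eq_of_toLocal_diagonal` (pure Galois side, any number field `K`): if
  `ρ : Γ_K → GL₂(ℂ)` restricted to `Γ_{K_v}` is `P diag(ψ₁, ψ₂) P⁻¹` with `ψ₂` trivial on the
  inertia group `I_{K_v}` and `ψ₁` non-trivial on it, then for the prime `𝔓₀ ∣ v` cut out by
  `K̄ ↪ \bar{K_v}` the inertia invariants `(ℂ²)^{I_{𝔓₀}}` are the line `P e₂`, every element of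
  the decomposition group `D_{𝔓₀}` is a restriction `res φ`, `φ ∈ Γ_{K_v}`, and
  `det(1 - T ρ(res φ) | (ℂ²)^{I_{𝔓₀}}) = 1 - ψ₂(φ) T` (Neukirch II (9.6), VII §10).
* `IsNewform1.exists_cuspCoeff_eq_of_toLocal_diagonal`: for a weight-one newform `f` of level
  `N`, `ρ` attached to `f` with that local shape at `v`, `p_v ∣ N`: `a_{p_v}(f) = ψ₂(φ)` for some
  `φ` (Deligne–Serre Thm. 4.6 (b) at `p ∣ N`, all pairs: `deligneSerre_eulerFactorAt_eq_of_dvd_level_holds`).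
* `norm_cuspCoeff_eq_one_of_toLocal_diagonal` (`p`-adic coefficients): for
  `ρ : Γ_ℚ → GL₂(ℚ̄_p)` with open kernel attached to `f` through `ι₁ : K_f → ℚ̄_p`, of local shape
  `P diag(χ₁, χ₂) P⁻¹` at `v ∣ p` with `χ₂` unramified of finite order and `χ₁` ramified, and
  `p ∣ N`: `|ι₁(a_p(f))|_p = 1`.

## References

* P. Deligne, J.-P. Serre, *Formes modulaires de poids 1*, Ann. Sci. ÉNS (4) 7 (1974), Thm. 4.6.
  [DeligneSerreASENS1974]
* J. Neukirch, *Algebraic Number Theory* (1999), Ch. II §9 Prop. (9.6); Ch. VII §10.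
  [NeukirchANT1999]
* P. B. Allen, Compos. Math. 150 (2014), Lemma 87 (arXiv:1301.1113v2, §5.1.1, p. 70). [Allen2014]
-/

noncomputable section

open scoped MatrixGroups Matrix ModularForm NumberField Polynomial Valued

open CongruenceSubgroup Polynomial IsDedekindDomain IsLocalRing Field
  Rat.HeightOneSpectrum Literature.NumberTheory.GaloisRepresentations
  Literature.NumberTheory.EllipticCurves Literature.NumberTheory.EllipticCurves.ModularForms
  Literature.NumberTheory.EllipticCurves.ModularForms.DeligneSerre1974

namespace Literature.NumberTheory.Automorphic

/-! ### Linear algebra: vectors of `ℂ²` -/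

section LinAlg

variable {R : Type*} [CommRing R]

/-- `(x - y)^rev`: `(X - c)^rev = 1 - c X`. [folklore] -/
private theorem reverse_X_sub_C_aux [Nontrivial R] (c : R) :
    (X - C c : R[X]).reverse = 1 - C c * X := by
  have hX : reverse (X : R[X]) = 1 := by
    rw [← one_mul X, reverse_mul_X, ← C_1, reverse_C]
  rw [sub_eq_add_neg, ← C_neg, reverse_add_C, hX, natDegree_X, pow_one, C_neg]
  ring

/-- A vector of `R²` with first coordinate `0` is a multiple of `e₂ = Pi.single 1 1`. [folklore] -/
private theorem eq_smul_single_of_apply_zero_eq_zero (u : Fin 2 → R) (hu : u 0 = 0) :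
    u = u 1 • (Pi.single 1 1 : Fin 2 → R) := by
  funext i
  fin_cases i
  · simp [hu]
  · simp

/-- `diag(a, b) u = b • u` when `u 0 = 0`. [folklore] -/
private theorem diagonal_mulVec_of_apply_zero_eq_zero (a b : R) (u : Fin 2 → R) (hu : u 0 = 0) :
    Matrix.diagonal ![a, b] *ᵥ u = b • u := by
  funext i
  rw [Matrix.mulVec_diagonal]
  fin_cases i
  · simp [hu]
  · simp

end LinAlg

/-! ### The Euler polynomial of a representation split at `v` with one unramified character -/

section Galois

variable {K : Type} [Field K] [NumberField K]

set_option maxHeartbeats 800000 in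
/-- **Inertia invariants and Euler polynomial of `P diag(ψ₁, ψ₂) P⁻¹` with `ψ₂` unramified,
`ψ₁` ramified.**  Let `ρ : Γ_K → GL₂(ℂ)` be continuous and suppose that on `Γ_{K_v}` (through
`res : Γ_{K_v} → Γ_K`) `P⁻¹ ρ(res σ) P = diag(ψ₁ σ, ψ₂ σ)` with `ψ₂ = 1` on the inertia group
`I_{K_v}` and `ψ₁(i₀) ≠ 1` for some `i₀ ∈ I_{K_v}`.  Then for the prime `𝔓₀ ∣ v` of `\bar ℤ_K`
cut out by `K̄ ↪ \bar{K_v}` (`I_{𝔓₀} = res(I_{K_v})`, `D_{𝔓₀} = res(Γ_{K_v})`, Neukirch II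
(9.6)): every `τ ∈ D_{𝔓₀}` is `res φ`, and `det(1 - T ρ(res φ) | (ℂ²)^{I_{𝔓₀}}) = 1 - ψ₂(φ) T`
(the invariants are the line `P e₂`, on which `ρ(res φ)` acts by `ψ₂(φ)`).
[cite: NeukirchANT1999, Ch. II §9 Prop. (9.6); Ch. VII §10 (10.1)] -/
theorem eulerPolynomial_eq_of_toLocal_diagonal (ρ : FramedArtinRep K 2)
    (v : HeightOneSpectrum (𝓞 K)) (P : GL (Fin 2) ℂ)
    (ψ₁ ψ₂ : absoluteGaloisGroup (v.adicCompletion K) → ℂ)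
    (hdiag : ∀ σ, ((P⁻¹ * ρ (absGaloisRestrict K (v.adicCompletion K) σ) * P : GL (Fin 2) ℂ) :
      Matrix (Fin 2) (Fin 2) ℂ) = Matrix.diagonal ![ψ₁ σ, ψ₂ σ])
    (hψ₂ : ∀ i ∈ absInertia (v.adicCompletion K), ψ₂ i = 1)
    (hψ₁ : ∃ i ∈ absInertia (v.adicCompletion K), ψ₁ i ≠ 1) :
    ∃ 𝔓 ∈ v.primesAbove,
      (∀ τ ∈ 𝔓.decompositionSubgroup (absoluteGaloisGroup K),
        ∃ φ, absGaloisRestrict K (v.adicCompletion K) φ = τ) ∧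
      ∀ (φ : absoluteGaloisGroup (v.adicCompletion K))
        (hφ : absGaloisRestrict K (v.adicCompletion K) φ ∈
          𝔓.decompositionSubgroup (absoluteGaloisGroup K)),
        ρ.toArtinRep.eulerPolynomial 𝔓 ⟨_, hφ⟩ = 1 - C (ψ₂ φ) * X := by
  classical
  -- ### the prime `𝔓₀ ∣ v` cut out by `K̄ ↪ \bar{K_v}` (Neukirch II (9.6))
  have hw := adicCompletion_valuation_le_one_iff K v
  have hO := norm_algebraMap_ringOfIntegers_le_one K v
  have hv' := norm_algebraMap_ringOfIntegers_lt_one_iff K v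
  have hd : DenseRange (algebraMap K (v.adicCompletion K)) :=
    IsDedekindDomain.HeightOneSpectrum.denseRange_algebraMap (K := K) (v := v)
  have hK := exists_norm_algebraMap_adicCompletion_lt_one K v
  obtain ⟨𝔓, h𝔓⟩ := exists_ideal_forall_mem_iff_spectralNorm_lt_one K (v.adicCompletion K) hO
  have h𝔓v : 𝔓 ∈ v.primesAbove := mem_primesAbove_of_forall_mem_iff v hv' 𝔓 h𝔓
  have hmax := HeightOneSpectrum.isMaximal_of_mem_primesAbove h𝔓v
  have hD := decompositionSubgroup_eq_range_absGaloisRestrict hd hO hK 𝔓 h𝔓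
  have hI := inertia_eq_map_absInertia_absGaloisRestrict hw hd hO hK 𝔓 h𝔓 hmax
  set res := absGaloisRestrict K (v.adicCompletion K) with hres
  refine ⟨𝔓, h𝔓v, fun τ hτ ↦ ?_, fun φ hφ ↦ ?_⟩
  · rw [hD] at hτ
    obtain ⟨φ, rfl⟩ := hτ
    exact ⟨φ, rfl⟩
  -- ### the matrices `ρ(res σ) = P diag(ψ₁ σ, ψ₂ σ) P⁻¹` and their action on `ℂ²`
  have hmat : ∀ σ, ((ρ (res σ) : GL (Fin 2) ℂ) : Matrix (Fin 2) (Fin 2) ℂ) =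
      (P : Matrix (Fin 2) (Fin 2) ℂ) * Matrix.diagonal ![ψ₁ σ, ψ₂ σ] *
        ((P⁻¹ : GL (Fin 2) ℂ) : Matrix (Fin 2) (Fin 2) ℂ) := by
    intro σ
    have h : ρ (res σ) = P * (P⁻¹ * ρ (res σ) * P) * P⁻¹ := by group
    conv_lhs => rw [h]
    rw [Units.val_mul, Units.val_mul, hdiag σ]
  have hPP : ((P⁻¹ : GL (Fin 2) ℂ) : Matrix (Fin 2) (Fin 2) ℂ) * (P : Matrix (Fin 2) (Fin 2) ℂ) = 1 := by
    rw [← Units.val_mul, inv_mul_cancel, Units.val_one]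
  have hPP' : (P : Matrix (Fin 2) (Fin 2) ℂ) * ((P⁻¹ : GL (Fin 2) ℂ) : Matrix (Fin 2) (Fin 2) ℂ) = 1 := by
    rw [← Units.val_mul, mul_inv_cancel, Units.val_one]
  have hact : ∀ σ (w : Fin 2 → ℂ), ρ.toArtinRep (res σ) w =
      (P : Matrix (Fin 2) (Fin 2) ℂ) *ᵥ (Matrix.diagonal ![ψ₁ σ, ψ₂ σ] *ᵥ
        (((P⁻¹ : GL (Fin 2) ℂ) : Matrix (Fin 2) (Fin 2) ℂ) *ᵥ w)) := by
    intro σ w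
    rw [FramedRep.toContinuousRep_apply_apply, hmat σ, ← Matrix.mulVec_mulVec, ← Matrix.mulVec_mulVec]
  -- ### the inertia invariants: `{w | (P⁻¹ w) 0 = 0}`
  obtain ⟨i₀, hi₀, hψi₀⟩ := hψ₁
  have hmemI : ∀ w : Fin 2 → ℂ,
      w ∈ ρ.toArtinRep.fixedSubmodule (𝔓.inertia (absoluteGaloisGroup K)) ↔
        (((P⁻¹ : GL (Fin 2) ℂ) : Matrix (Fin 2) (Fin 2) ℂ) *ᵥ w) 0 = 0 := by
    intro w
    rw [ContinuousRep.mem_fixedSubmodule_iff, hI]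
    constructor
    · intro h
      have h1 := h (res i₀) ⟨i₀, hi₀, rfl⟩
      rw [hact] at h1
      -- apply `P⁻¹` to both sides
      have h2 := congrArg (fun x ↦ ((P⁻¹ : GL (Fin 2) ℂ) : Matrix (Fin 2) (Fin 2) ℂ) *ᵥ x) h1
      rw [Matrix.mulVec_mulVec, hPP, Matrix.one_mulVec] at h2
      have h3 := congrFun h2 0
      rw [Matrix.mulVec_diagonal] at h3
      simp only [Matrix.cons_val_zero] at h3
      have h4 : (ψ₁ i₀ - 1) * ((((P⁻¹ : GL (Fin 2) ℂ) : Matrix (Fin 2) (Fin 2) ℂ) *ᵥ w) 0) = 0 := by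
        rw [sub_mul, one_mul, sub_eq_zero]
        exact h3
      exact (mul_eq_zero.mp h4).resolve_left (sub_ne_zero.mpr hψi₀)
    · rintro h _ ⟨i, hi, rfl⟩
      change ρ.toArtinRep (res i) w = w
      rw [hact, diagonal_mulVec_of_apply_zero_eq_zero _ _ _ h, hψ₂ i hi, one_smul,
        Matrix.mulVec_mulVec, hPP', Matrix.one_mulVec]
  -- the line `P e₂`
  set e : Fin 2 → ℂ := (P : Matrix (Fin 2) (Fin 2) ℂ) *ᵥ (Pi.single 1 1) with he
  have hPe : ((P⁻¹ : GL (Fin 2) ℂ) : Matrix (Fin 2) (Fin 2) ℂ) *ᵥ e = Pi.single 1 1 := by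
    rw [he, Matrix.mulVec_mulVec, hPP, Matrix.one_mulVec]
  have he0 : e ≠ 0 := by
    intro h0
    have h := hPe
    rw [h0, Matrix.mulVec_zero] at h
    have := congrFun h 1
    simp at this
  have hspan : ρ.toArtinRep.fixedSubmodule (𝔓.inertia (absoluteGaloisGroup K)) = ℂ ∙ e := by
    ext w
    rw [hmemI, Submodule.mem_span_singleton]
    constructor
    · intro hw0
      refine ⟨(((P⁻¹ : GL (Fin 2) ℂ) : Matrix (Fin 2) (Fin 2) ℂ) *ᵥ w) 1, ?_⟩
      have hu := eq_smul_single_of_apply_zero_eq_zero _ hw0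
      have h := congrArg (fun x ↦ (P : Matrix (Fin 2) (Fin 2) ℂ) *ᵥ x) hu
      simp only [Matrix.mulVec_mulVec, hPP', Matrix.one_mulVec, Matrix.mulVec_smul] at h
      exact h.symm
    · rintro ⟨c, rfl⟩
      rw [Matrix.mulVec_smul, hPe]
      simp
  have hfin : Module.finrank ℂ (ρ.toArtinRep.fixedSubmodule (𝔓.inertia (absoluteGaloisGroup K))) = 1 := by
    rw [hspan, finrank_span_singleton he0]
  -- ### `ρ(res φ)` acts on the invariants by `ψ₂ φ`
  have hscal : ρ.toArtinRep.restrictInertiaInvariants 𝔓 ⟨res φ, hφ⟩ = (ψ₂ φ) • LinearMap.id := by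
    refine LinearMap.ext fun w ↦ Subtype.ext ?_
    rw [ContinuousRep.restrictInertiaInvariants_apply, LinearMap.smul_apply, LinearMap.id_apply,
      Submodule.coe_smul]
    change ρ.toArtinRep (res φ) (w : Fin 2 → ℂ) = ψ₂ φ • (w : Fin 2 → ℂ)
    have hw0 := (hmemI w).mp w.2
    rw [hact, diagonal_mulVec_of_apply_zero_eq_zero _ _ _ hw0, Matrix.mulVec_smul,
      Matrix.mulVec_mulVec, hPP', Matrix.one_mulVec]
  rw [ArtinRep.eulerPolynomial, LinearMap.charpoly_eq_X_sub_C_det_of_finrank_eq_one hfin, hscal,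
    LinearMap.det_smul, LinearMap.det_id, mul_one, hfin, pow_one, reverse_X_sub_C_aux]

end Galois

/-! ### Deligne–Serre Thm. 4.6 (b): `a_p(f) = ψ₂(φ)` -/

section Newform

/-- **`a_p(f)` is a value of the unramified character** (Deligne–Serre 1974, Thm. 4.6 (b) at
`p ∣ N`, all pairs, `deligneSerre_eulerFactorAt_eq_of_dvd_level_holds`): for a weight-one newform
`f` of level `N`, a continuous `ρ : Γ_ℚ → GL₂(ℂ)` attached to `f` away from `N` whose restriction
to `Γ_{ℚ_v}` is `P diag(ψ₁, ψ₂) P⁻¹` with `ψ₂` unramified and `ψ₁` ramified, and `p_v ∣ N`,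
there is `φ ∈ Γ_{ℚ_v}` (a Frobenius) with `a_{p_v}(f) = ψ₂(φ)`.
[cite: DeligneSerreASENS1974, Thm. 4.6 (b)] [cite: NeukirchANT1999, Ch. II §9 Prop. (9.6)] -/
theorem IsNewform1.exists_cuspCoeff_eq_of_toLocal_diagonal {N : ℕ} [NeZero N]
    {f : CuspForm (Gamma1 N) 1} {ρ : FramedArtinRep ℚ 2} (hf : IsNewform1 f)
    (hρ : IsGaloisRepOfNewform1 f (algebraMap (coeffCharField f) ℂ) {p | p ∣ N} ρ)
    {v : HeightOneSpectrum (𝓞 ℚ)} (hv : ((primesEquiv v : Nat.Primes) : ℕ) ∣ N)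
    (P : GL (Fin 2) ℂ) (ψ₁ ψ₂ : absoluteGaloisGroup (v.adicCompletion ℚ) → ℂ)
    (hdiag : ∀ σ, ((P⁻¹ * ρ (absGaloisRestrict ℚ (v.adicCompletion ℚ) σ) * P : GL (Fin 2) ℂ) :
      Matrix (Fin 2) (Fin 2) ℂ) = Matrix.diagonal ![ψ₁ σ, ψ₂ σ])
    (hψ₂ : ∀ i ∈ absInertia (v.adicCompletion ℚ), ψ₂ i = 1)
    (hψ₁ : ∃ i ∈ absInertia (v.adicCompletion ℚ), ψ₁ i ≠ 1) :
    ∃ φ : absoluteGaloisGroup (v.adicCompletion ℚ),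
      cuspCoeff f ((primesEquiv v : Nat.Primes) : ℕ) = ψ₂ φ := by
  obtain ⟨𝔓, h𝔓v, hsurj, hE⟩ := eulerPolynomial_eq_of_toLocal_diagonal ρ v P ψ₁ ψ₂ hdiag hψ₂ hψ₁
  haveI := h𝔓v.1
  obtain ⟨σ, hσ⟩ := HeightOneSpectrum.exists_isArithFrobAt_of_mem_primesAbove_holds h𝔓v
  obtain ⟨φ, hφσ⟩ := hsurj σ hσ.mem_stabilizer
  have hDS := deligneSerre_eulerPolynomial_eq_of_dvd_level_of_eulerFactorAt
    deligneSerre_eulerFactorAt_eq_of_dvd_level_holds hf hρ hv h𝔓v hσ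
  subst hφσ
  have h := (hE φ hσ.mem_stabilizer).symm.trans hDS
  -- compare the coefficients of `X`
  have h1 := congrArg (fun q : ℂ[X] ↦ q.coeff 1) h
  simp only [coeff_sub, coeff_one, coeff_C_mul, coeff_X_one, mul_one, one_ne_zero, if_false,
    zero_sub, neg_inj] at h1
  exact ⟨φ, h1.symm⟩

end Newform

/-! ### `p`-adic coefficients: `|ι₁ a_p(f)|_p = 1` -/

section Padic

variable {p : ℕ} [Fact p.Prime]

set_option maxHeartbeats 800000 in
/-- **`a_p(f)` is a `p`-adic unit when `ρ_f|_{Γ_{ℚ_p}} ≅ χ₁ ⊕ χ₂` with `χ₂` unramified of finite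
order and `χ₁` ramified** (`p ∣ N`; Deligne–Serre Thm. 4.6 (b): `a_p = χ₂(Frob_p)`, a root of
unity), for a `p`-adic representation `ρ : Γ_ℚ → GL₂(ℚ̄_p)` with open kernel attached to the
weight-one newform `f` through `ι₁ : K_f → ℚ̄_p` (transport to `ℂ` along `ι ⊇ ι₁`,
`exists_ringEquiv_padicAlgCl_complex_extends`, `exists_map_of_isOpen_ker`).
[cite: DeligneSerreASENS1974, Thm. 4.6 (b)] [cite: Allen2014, Lemma 87 (p. 70)] -/
theorem norm_cuspCoeff_eq_one_of_toLocal_diagonal {N₁ : ℕ} [NeZero N₁]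
    (f₁ : CuspForm (Gamma1 N₁) 1) (ι₁ : coeffCharField f₁ →+* PadicAlgCl p)
    (ρ₁ : FramedGaloisRep ℚ (PadicAlgCl p) 2) (hf₁ : IsNewform1 f₁)
    (hρ₁ : IsGaloisRepOfNewform1 f₁ ι₁ {q | q ∣ N₁} ρ₁)
    (hopen : IsOpen ((ρ₁ : absoluteGaloisGroup ℚ →* GL (Fin 2) (PadicAlgCl p)).ker :
      Set (absoluteGaloisGroup ℚ)))
    {v : HeightOneSpectrum (𝓞 ℚ)} (hv : ((p : ℕ) : 𝓞 ℚ) ∈ v.asIdeal) (hpN : p ∣ N₁)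
    (P : GL (Fin 2) (PadicAlgCl p)) (χ₁ χ₂ : absoluteGaloisGroup (v.adicCompletion ℚ) → PadicAlgCl p)
    (hdiag : ∀ σ, ((P⁻¹ * ρ₁.toLocal v σ * P : GL (Fin 2) (PadicAlgCl p)) :
      Matrix (Fin 2) (Fin 2) (PadicAlgCl p)) = Matrix.diagonal ![χ₁ σ, χ₂ σ])
    (hχ₂ : ∀ i ∈ absInertia (v.adicCompletion ℚ), χ₂ i = 1)
    (hχ₁ : ∃ i ∈ absInertia (v.adicCompletion ℚ), χ₁ i ≠ 1)
    {n : ℕ} (hn : 0 < n) (hχ₂n : ∀ σ, χ₂ σ ^ n = 1) :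
    ‖ι₁ ⟨(UpperHalfPlane.qExpansion 1 ⇑f₁).coeff p, cuspCoeff_mem_coeffCharField f₁ p⟩‖ = 1 := by
  classical
  have hp : p.Prime := Fact.out
  -- ### `K_{f₁}` is a number field; `ι ⊇ ι₁`
  have hL := DeligneSerre1974_span_integralLattice1_holds N₁ 1
  haveI : FiniteDimensional ℚ (coeffField f₁) :=
    (IsNewform1.finiteDimensional_coeffField_of_span_integralLattice1 hL) hf₁
  haveI : FiniteDimensional ℚ (coeffCharField f₁) := finiteDimensional_coeffCharField f₁
  haveI : NumberField (coeffCharField f₁) := NumberField.mk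
  obtain ⟨ι, hι⟩ := exists_ringEquiv_padicAlgCl_complex_extends ι₁ (algebraMap (coeffCharField f₁) ℂ)
  have hιsymm : ∀ x : coeffCharField f₁, ι.symm (x : ℂ) = ι₁ x := fun x ↦ by
    apply ι.injective
    rw [RingEquiv.apply_symm_apply, hι x]
    rfl
  -- ### the complex transport `ρℂ` of `ρ₁`, attached to `f₁` through `K_{f₁} ⊆ ℂ`
  obtain ⟨ρℂ, hρℂ, -, -⟩ := ρ₁.exists_map_of_isOpen_ker hopen (ι : PadicAlgCl p →+* ℂ)
  have hcomp : (ι : PadicAlgCl p →+* ℂ).comp ι₁ = algebraMap (coeffCharField f₁) ℂ :=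
    RingHom.ext fun x ↦ hι x
  have hρℂf : IsGaloisRepOfNewform1 f₁ (algebraMap (coeffCharField f₁) ℂ) {q | q ∣ N₁} ρℂ := by
    rw [← hcomp]
    exact hρ₁.of_map _ hρℂ
  -- its local shape: `Pℂ diag(ι χ₁, ι χ₂) Pℂ⁻¹`
  set Pℂ : GL (Fin 2) ℂ := Matrix.GeneralLinearGroup.map (ι : PadicAlgCl p →+* ℂ) P with hPℂ
  have hdiagℂ : ∀ σ, ((Pℂ⁻¹ * ρℂ (absGaloisRestrict ℚ (v.adicCompletion ℚ) σ) * Pℂ : GL (Fin 2) ℂ) :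
      Matrix (Fin 2) (Fin 2) ℂ) = Matrix.diagonal ![ι (χ₁ σ), ι (χ₂ σ)] := by
    intro σ
    have h1 : Pℂ⁻¹ * ρℂ (absGaloisRestrict ℚ (v.adicCompletion ℚ) σ) * Pℂ =
        Matrix.GeneralLinearGroup.map (ι : PadicAlgCl p →+* ℂ) (P⁻¹ * ρ₁.toLocal v σ * P) := by
      rw [map_mul, map_mul, map_inv, hPℂ, hρℂ, FramedGaloisRep.toLocal_apply]
    rw [h1]
    change ((P⁻¹ * ρ₁.toLocal v σ * P : GL (Fin 2) (PadicAlgCl p)) :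
      Matrix (Fin 2) (Fin 2) (PadicAlgCl p)).map (ι : PadicAlgCl p →+* ℂ) = _
    rw [hdiag σ, Matrix.diagonal_map (map_zero _)]
    congr 1
    funext i
    fin_cases i <;> rfl
  have hψ₂ : ∀ i ∈ absInertia (v.adicCompletion ℚ), (fun σ ↦ ι (χ₂ σ)) i = 1 := fun i hi ↦ by
    simp only [hχ₂ i hi, map_one]
  have hψ₁ : ∃ i ∈ absInertia (v.adicCompletion ℚ), (fun σ ↦ ι (χ₁ σ)) i ≠ 1 := by
    obtain ⟨i, hi, hne⟩ := hχ₁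
    exact ⟨i, hi, fun h ↦ hne (ι.injective (by rw [map_one]; exact h))⟩
  -- ### `p_v = p ∣ N₁`, and Thm. 4.6 (b)
  have hPv : ((primesEquiv v : Nat.Primes) : ℕ) = p := by
    have hdvd : natGenerator v ∣ p := (Rat.natCast_mem_asIdeal_iff (v := v)).mp hv
    exact (Nat.prime_dvd_prime_iff_eq (primesEquiv v).2 hp).mp hdvd
  have hvN : ((primesEquiv v : Nat.Primes) : ℕ) ∣ N₁ := hPv ▸ hpN
  obtain ⟨φ, hφ⟩ := IsNewform1.exists_cuspCoeff_eq_of_toLocal_diagonal hf₁ hρℂf hvN Pℂ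
    (fun σ ↦ ι (χ₁ σ)) (fun σ ↦ ι (χ₂ σ)) hdiagℂ hψ₂ hψ₁
  rw [hPv] at hφ
  -- ### conclusion: `ι₁ a_p = χ₂ φ`, a root of unity
  have hval : ι₁ ⟨(UpperHalfPlane.qExpansion 1 ⇑f₁).coeff p, cuspCoeff_mem_coeffCharField f₁ p⟩ =
      χ₂ φ := by
    rw [← hιsymm]
    change ι.symm (cuspCoeff f₁ p) = χ₂ φ
    rw [hφ, RingEquiv.symm_apply_apply]
  rw [hval]
  exact Literature.NumberTheory.GaloisRepresentations.PadicAlgCl.norm_eq_one_of_pow_eq_one hn.ne'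
    (hχ₂n φ)

end Padic

end Literature.NumberTheory.Automorphic

end
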